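import Mathlib
import Summits.NavierStokesRegularity.NavierStokesRegularity.Theorems.EulerZoomLiouvillePowerGaugeEulerLiouvilleSelfSimilarPastExtension
import Summits.NavierStokesRegularity.NavierStokesRegularity.Theorems.EulerZoomLiouvillePowerGaugeEulerLiouvilleSpiralProfileGradient
import HarnessLib

/-!
# Crux `EulerZoomLiouville.PowerGaugeEulerLiouville` (stmt-NavierStokesRegularity-19832), line `relative_equilibria` (ns-idea-11), R3a PORT RECIPE
# brick P2 (Theorems-side port): THE `A`-GAUGE OF A SPIRAL MEMBER IN PROFILE VARIABLES — `∫_{B_L} ‖V‖² ≤ C L^{1−2ρ}` (large scales)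

Route №10 `EulerZoomLiouville` (NavierStokesRegularity), crux E; width seat ns-ezl-w1 g10 under the LEAD ns-typeII-p2 g17 (R3a-ASM prerequisites).
ns-idea-11 g11 proved P2 inside the LINE file (`Lines/relative_equilibria.lean` REV5, `spiral_energy_growth_of_gaugeA_past`); Cruxes modules are not importable,
so the assembly `Spiral.exists_locData_of_pastSpiral` (R3a-ASM) needs the brick in `Theorems/`.  This file is that port, VERBATIM up to the conventions of the
`Spiral` namespace (skewness unfolded `⟪Sx, y⟫ = −⟪x, Sy⟫`, `twist S s` written `NormedSpace.exp (s • S)`):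

* `Spiral.norm_exp_smul_skew_apply` — `‖e^{sS} v‖ = ‖v‖`;
* ★ `Spiral.profile_energy_growth_of_gaugeA_pastSpiral` — spiral member about `(T, x₀)` for `τ < T₁` (`0 < ρ ≤ ½`, `T₁ ≤ 0`, `T₁ ≤ T`) + `a^{2ρ}A(a;0) ≤ c`
  ⇒ `∫_{B_L}‖V‖² ≤ C L^{1−2ρ}` for `L ≥ 2 − T₁` (untwisted `Shifted.profile_energy_growth_of_gaugeA_past` with the rotated affine chart `x = x₀ + σ e^{(log s)S} y`).

WHAT THIS IS NOT: not NS, not E, not a stub: one brick (P2) of the port R3a of a width sub-line; 19832 OPEN; no summit statement is proved by this file.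
[folklore; ChaeTsai2013DSS p. 4 (Perelman's rotated ansatz)]
-/

noncomputable section

-- flat `Theorems/<Route><Decl>…` files of one crux share the namespace of the crux (tree convention: `Summit.<S>.<S>.…`)
set_option linter.dupNamespace false

open MeasureTheory Set Filter Topology Metric Function TopologicalSpace Real
open scoped ENNReal NNReal RealInnerProductSpace

namespace Summit.NavierStokesRegularity.NavierStokesRegularity.Theorems.PowerGaugeEulerLiouville

open Literature.Analysis Literature.Analysis.FunctionSpaces Literature.Analysis.FluidPDE

namespace Spiral

variable {S : EuclideanSpace ℝ (Fin 3) →L[ℝ] EuclideanSpace ℝ (Fin 3)}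

/-- Rotations by a skew generator preserve the norm: `‖e^{sS} v‖ = ‖v‖`. [folklore] -/
theorem norm_exp_smul_skew_apply (hS : ∀ x y : EuclideanSpace ℝ (Fin 3), ⟪S x, y⟫ = -⟪x, S y⟫) (s : ℝ) (v : EuclideanSpace ℝ (Fin 3)) :
    ‖NormedSpace.exp (s • S) v‖ = ‖v‖ := by
  obtain ⟨R, hR, -⟩ := exists_rot hS s
  rw [← hR]
  exact R.norm_map v

/-- ★ **P2 OF THE R3a PORT RECIPE: THE `A`-GAUGE OF A SPIRAL MEMBER IN PROFILE VARIABLES (large scales).**  The spiral version of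
`Shifted.profile_energy_growth_of_gaugeA_past` (…SelfSimilarPastExtension), same threshold `L ≥ 2 − T₁` and the same constant: if
`u(τ, x) = λ^{γ−1} e^{(log λ)S} V(e^{−(log λ)S} λ^{−γ}(x − x₀))` for `τ < T₁` (`λ = T − τ`, `γ = 1/(2+ρ)`, `0 < ρ ≤ ½`, `T₁ ≤ 0`, `T₁ ≤ T`,
`S` skew) and `a^{2ρ} A(a; 0) ≤ c` for all `a > 0`, then `∫_{B_L} ‖V‖² ≤ C L^{1−2ρ}` for every `L ≥ 2 − T₁`, some `C < ∞`.  The proof is the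
untwisted one VERBATIM except for the change of variables `x = x₀ + σ e^{(log s)S} y` on the far-past slice: the rotation is absorbed by
`Killing.setLIntegral_ball_comp_expSkew` (origin-centred balls are rotation invariant) and `‖e^{sS}v‖ = ‖v‖` — KEY ALGEBRA (i) of the recipe.
Port to `Theorems/` of ns-idea-11 g11's in-file proof (`Lines/relative_equilibria.lean` REV5 `spiral_energy_growth_of_gaugeA_past`), line predicates unfolded. [folklore] -/
theorem profile_energy_growth_of_gaugeA_pastSpiral {ρ : ℝ} (hρ : 0 < ρ) (hρh : ρ ≤ 1 / 2) {T T₁ : ℝ} (hT₁ : T₁ ≤ 0) (hTT₁ : T₁ ≤ T)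
    (x₀ : EuclideanSpace ℝ (Fin 3)) (hS : ∀ x y : EuclideanSpace ℝ (Fin 3), ⟪S x, y⟫ = -⟪x, S y⟫)
    {u : ℝ → EuclideanSpace ℝ (Fin 3) → EuclideanSpace ℝ (Fin 3)} {V : EuclideanSpace ℝ (Fin 3) → EuclideanSpace ℝ (Fin 3)} {c : ℝ≥0}
    (hu : ∀ τ : ℝ, τ < T₁ → u τ = fun x => (T - τ) ^ (1 / (2 + ρ) - 1) •
      NormedSpace.exp ((Real.log (T - τ)) • S) (V (NormedSpace.exp ((-Real.log (T - τ)) • S) ((T - τ) ^ (-(1 / (2 + ρ))) • (x - x₀)))))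
    (hA : ∀ a : ℝ, 0 < a → ENNReal.ofReal (a ^ (2 * ρ)) * cknA a (0 : ℝ × EuclideanSpace ℝ (Fin 3)) u ≤ (c : ℝ≥0∞)) :
    ∃ C : ℝ≥0∞, C ≠ ⊤ ∧ ∀ L : ℝ, 2 - T₁ ≤ L →
      ∫⁻ y in ball (0 : EuclideanSpace ℝ (Fin 3)) L, ‖V y‖ₑ ^ 2 ≤ C * ENNReal.ofReal (L ^ (1 - 2 * ρ)) := by
  have hSx : ∀ x : EuclideanSpace ℝ (Fin 3), ⟪S x, x⟫ = 0 := fun x => inner_self_of_skew hS x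
  set γ : ℝ := 1 / (2 + ρ) with hγ
  -- the far-past slice `τ₁ = T₁ − 1` and `s = T − τ₁ ≥ 1`
  set τ₁ : ℝ := T₁ - 1 with hτ₁
  set s : ℝ := T - T₁ + 1 with hs
  have hs0 : 0 < s := by rw [hs]; linarith
  have hsτ : T - τ₁ = s := by rw [hτ₁, hs]; ring
  set σ : ℝ := s ^ γ with hσ
  have hσ0 : 0 < σ := Real.rpow_pos_of_pos hs0 _
  have h12ρ : 0 ≤ 1 - 2 * ρ := by linarith
  set k : ℝ := s ^ (2 - 2 * γ) * (σ ^ 3)⁻¹ * (σ + ‖x₀‖) ^ (1 - 2 * ρ) with hk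
  refine ⟨ENNReal.ofReal k * (c : ℝ≥0∞), ENNReal.mul_ne_top ENNReal.ofReal_ne_top ENNReal.coe_ne_top, fun L hL => ?_⟩
  have hL2 : 2 ≤ L := by linarith
  have hL0 : 0 < L := by linarith
  -- the radius `a`
  set a : ℝ := L * σ + ‖x₀‖ with ha
  have hσ1 : 1 ≤ σ := by
    rw [hσ]; exact Real.one_le_rpow (by rw [hs]; linarith) (by rw [hγ]; positivity)
  have haL : L ≤ a := by
    have : L * 1 ≤ L * σ := mul_le_mul_of_nonneg_left hσ1 hL0.le
    have := norm_nonneg x₀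
    rw [ha]; linarith
  have ha0 : 0 < a := by linarith
  have ha2 : 1 - T₁ < a ^ 2 := by nlinarith
  have hτ : τ₁ ∈ Ioo ((0 : ℝ × EuclideanSpace ℝ (Fin 3)).1 - a ^ 2) (0 : ℝ × EuclideanSpace ℝ (Fin 3)).1 := by
    simp only [Prod.fst_zero, zero_sub, mem_Ioo]
    constructor <;> [rw [hτ₁]; rw [hτ₁]] <;> linarith
  have hslice : (ENNReal.ofReal a)⁻¹ * ∫⁻ x in ball (0 : EuclideanSpace ℝ (Fin 3)) a, ‖u τ₁ x‖ₑ ^ 2 ≤ cknA a (0 : ℝ × EuclideanSpace ℝ (Fin 3)) u := by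
    unfold cknA
    exact le_iSup₂ (f := fun t (_ : t ∈ Ioo ((0 : ℝ × EuclideanSpace ℝ (Fin 3)).1 - a ^ 2) (0 : ℝ × EuclideanSpace ℝ (Fin 3)).1) =>
        (ENNReal.ofReal a)⁻¹ * ∫⁻ x in ball (0 : ℝ × EuclideanSpace ℝ (Fin 3)).2 a, ‖u t x‖ₑ ^ 2) τ₁ hτ
  set I : ℝ≥0∞ := ∫⁻ x in ball (0 : EuclideanSpace ℝ (Fin 3)) a, ‖u τ₁ x‖ₑ ^ 2 with hI
  have hgauge : ENNReal.ofReal (a ^ (2 * ρ)) * ((ENNReal.ofReal a)⁻¹ * I) ≤ (c : ℝ≥0∞) :=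
    calc ENNReal.ofReal (a ^ (2 * ρ)) * ((ENNReal.ofReal a)⁻¹ * I)
        ≤ ENNReal.ofReal (a ^ (2 * ρ)) * cknA a (0 : ℝ × EuclideanSpace ℝ (Fin 3)) u := by gcongr
      _ ≤ (c : ℝ≥0∞) := hA a ha0
  have hKa : ENNReal.ofReal (a ^ (2 * ρ)) * (ENNReal.ofReal a)⁻¹ = ENNReal.ofReal (a ^ (2 * ρ - 1)) := by
    rw [← ENNReal.ofReal_inv_of_pos ha0, ← ENNReal.ofReal_mul (by positivity), Real.rpow_sub_one ha0.ne',
      div_eq_mul_inv]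
  have hIle : I ≤ ENNReal.ofReal (a ^ (1 - 2 * ρ)) * (c : ℝ≥0∞) := by
    have hunit : ENNReal.ofReal (a ^ (1 - 2 * ρ)) * ENNReal.ofReal (a ^ (2 * ρ - 1)) = 1 := by
      rw [← ENNReal.ofReal_mul (by positivity), ← Real.rpow_add ha0, show (1 - 2 * ρ) + (2 * ρ - 1) = 0 by ring,
        Real.rpow_zero, ENNReal.ofReal_one]
    calc I = ENNReal.ofReal (a ^ (1 - 2 * ρ)) * (ENNReal.ofReal (a ^ (2 * ρ - 1)) * I) := by
          rw [← mul_assoc, hunit, one_mul]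
      _ = ENNReal.ofReal (a ^ (1 - 2 * ρ)) * (ENNReal.ofReal (a ^ (2 * ρ)) * ((ENNReal.ofReal a)⁻¹ * I)) := by
          rw [← mul_assoc (ENNReal.ofReal (a ^ (2 * ρ))), hKa]
      _ ≤ ENNReal.ofReal (a ^ (1 - 2 * ρ)) * (c : ℝ≥0∞) := by gcongr
  -- ### change of variables `x = x₀ + σ e^{(log s) S} y` on the far-past slice (the ROTATED affine chart)
  have hval : ∀ y : EuclideanSpace ℝ (Fin 3),
      ‖u τ₁ (x₀ + σ • NormedSpace.exp ((Real.log s) • S) y)‖ₑ ^ 2 = ENNReal.ofReal (s ^ (2 * (γ - 1))) * ‖V y‖ₑ ^ 2 := by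
    intro y
    rw [hu τ₁ (by rw [hτ₁]; linarith)]
    simp only [add_sub_cancel_left, smul_smul]
    rw [hsτ, hσ, ← Real.rpow_add hs0, show -γ + γ = 0 by ring, Real.rpow_zero, one_smul]
    have hback : NormedSpace.exp ((-Real.log s) • S) (NormedSpace.exp ((Real.log s) • S) y) = y :=
      Killing.expSkew_neg_apply_expSkew S (Real.log s) y
    rw [hback, enorm_smul, mul_pow, Real.enorm_eq_ofReal (Real.rpow_nonneg hs0.le _),
      ← ENNReal.ofReal_pow (Real.rpow_nonneg hs0.le _), ← Real.rpow_natCast (s ^ (γ - 1)) 2,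
      ← Real.rpow_mul hs0.le, show (γ - 1) * ((2 : ℕ) : ℝ) = 2 * (γ - 1) by push_cast; ring]
    congr 1
    rw [← ofReal_norm, ← ofReal_norm, norm_exp_smul_skew_apply hS]
  have hpre : ball (0 : EuclideanSpace ℝ (Fin 3)) L ⊆ (fun y : EuclideanSpace ℝ (Fin 3) => x₀ + σ • y) ⁻¹' ball (0 : EuclideanSpace ℝ (Fin 3)) a := by
    intro y hy
    rw [mem_ball_zero_iff] at hy
    rw [mem_preimage, mem_ball_zero_iff]
    calc ‖x₀ + σ • y‖ ≤ ‖x₀‖ + ‖σ • y‖ := norm_add_le _ _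
      _ = ‖x₀‖ + σ * ‖y‖ := by rw [norm_smul, Real.norm_of_nonneg hσ0.le]
      _ < ‖x₀‖ + σ * L := by gcongr
      _ = a := by rw [ha]; ring
  have hcov := setLIntegral_preimage_comp_space_affine hσ0 x₀ (fun x : EuclideanSpace ℝ (Fin 3) => ‖u τ₁ x‖ₑ ^ 2) (ball (0 : EuclideanSpace ℝ (Fin 3)) a)
  rw [finrank_euclideanSpace_fin] at hcov
  -- the rotation is absorbed by the rotation invariance of origin-centred ball integrals
  have hrot : ∫⁻ y in ball (0 : EuclideanSpace ℝ (Fin 3)) L, ‖u τ₁ (x₀ + σ • NormedSpace.exp ((Real.log s) • S) y)‖ₑ ^ 2 =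
      ∫⁻ z in ball (0 : EuclideanSpace ℝ (Fin 3)) L, ‖u τ₁ (x₀ + σ • z)‖ₑ ^ 2 := by
    have h := Killing.setLIntegral_ball_comp_expSkew hSx (Real.log s) (fun z : EuclideanSpace ℝ (Fin 3) => ‖u τ₁ (x₀ + σ • z)‖ₑ ^ 2) L
    simpa using h
  have hmain : ENNReal.ofReal (s ^ (2 * (γ - 1))) * ∫⁻ y in ball (0 : EuclideanSpace ℝ (Fin 3)) L, ‖V y‖ₑ ^ 2 ≤ ENNReal.ofReal (σ ^ 3)⁻¹ * I := by
    rw [← hcov, ← lintegral_const_mul' _ _ ENNReal.ofReal_ne_top]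
    calc ∫⁻ y in ball (0 : EuclideanSpace ℝ (Fin 3)) L, ENNReal.ofReal (s ^ (2 * (γ - 1))) * ‖V y‖ₑ ^ 2
        = ∫⁻ y in ball (0 : EuclideanSpace ℝ (Fin 3)) L, ‖u τ₁ (x₀ + σ • NormedSpace.exp ((Real.log s) • S) y)‖ₑ ^ 2 :=
          lintegral_congr fun y => (hval y).symm
      _ = ∫⁻ z in ball (0 : EuclideanSpace ℝ (Fin 3)) L, ‖u τ₁ (x₀ + σ • z)‖ₑ ^ 2 := hrot
      _ ≤ ∫⁻ y in (fun y : EuclideanSpace ℝ (Fin 3) => x₀ + σ • y) ⁻¹' ball (0 : EuclideanSpace ℝ (Fin 3)) a, ‖u τ₁ (x₀ + σ • y)‖ₑ ^ 2 := lintegral_mono_set hpre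
  -- ### assemble
  have haL' : a ^ (1 - 2 * ρ) ≤ (σ + ‖x₀‖) ^ (1 - 2 * ρ) * L ^ (1 - 2 * ρ) := by
    rw [← Real.mul_rpow (by positivity) hL0.le]
    refine Real.rpow_le_rpow ha0.le ?_ h12ρ
    have : ‖x₀‖ ≤ ‖x₀‖ * L := le_mul_of_one_le_right (norm_nonneg _) (by linarith)
    rw [ha]; nlinarith
  have hunit2 : ENNReal.ofReal (s ^ (2 - 2 * γ)) * ENNReal.ofReal (s ^ (2 * (γ - 1))) = 1 := by
    rw [← ENNReal.ofReal_mul (Real.rpow_nonneg hs0.le _), ← Real.rpow_add hs0,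
      show (2 - 2 * γ) + 2 * (γ - 1) = 0 by ring, Real.rpow_zero, ENNReal.ofReal_one]
  calc ∫⁻ y in ball (0 : EuclideanSpace ℝ (Fin 3)) L, ‖V y‖ₑ ^ 2
      = ENNReal.ofReal (s ^ (2 - 2 * γ)) *
          (ENNReal.ofReal (s ^ (2 * (γ - 1))) * ∫⁻ y in ball (0 : EuclideanSpace ℝ (Fin 3)) L, ‖V y‖ₑ ^ 2) := by
        rw [← mul_assoc, hunit2, one_mul]
    _ ≤ ENNReal.ofReal (s ^ (2 - 2 * γ)) * (ENNReal.ofReal (σ ^ 3)⁻¹ * I) := by gcongr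
    _ ≤ ENNReal.ofReal (s ^ (2 - 2 * γ)) * (ENNReal.ofReal (σ ^ 3)⁻¹ *
          (ENNReal.ofReal (a ^ (1 - 2 * ρ)) * (c : ℝ≥0∞))) := by gcongr
    _ ≤ ENNReal.ofReal (s ^ (2 - 2 * γ)) * (ENNReal.ofReal (σ ^ 3)⁻¹ *
          (ENNReal.ofReal ((σ + ‖x₀‖) ^ (1 - 2 * ρ) * L ^ (1 - 2 * ρ)) * (c : ℝ≥0∞))) := by
        gcongr
    _ = ENNReal.ofReal k * (c : ℝ≥0∞) * ENNReal.ofReal (L ^ (1 - 2 * ρ)) := by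
        rw [hk, ENNReal.ofReal_mul (by positivity), ENNReal.ofReal_mul (by positivity),
          ENNReal.ofReal_mul (by positivity)]
        ring


end Spiral

end Summit.NavierStokesRegularity.NavierStokesRegularity.Theorems.PowerGaugeEulerLiouville

end
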